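import Summits.QuantumFields.YangMills.Theorems.BalabanLadderIRTwistedSlabVacuumOrbits
import HarnessLib

/-!
# Separation of the twisted Wilson action away from the classical vacua (`hsep` of the Laplace method, configuration-space form)

HELPER toward stub **T1** `TwistedSlabAnchor` (LINE `twisted-slab-continuity`, crux `IRcof` stmt-QuantumFields-26930, census row 43;
LEAD prover ym-ir-line-tsc-p1 g3; `--supports` the crux, `--as helper`).  Companion of K2 (`…TwistedSlabVacuumOrbits`: the zero set of the
twisted Wilson action of the magnetic `SU(N)` slab is the union of the gauge orbits of the decorated twist-eating ladders) and of K3–K6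
(transversal non-degeneracy, `C^∞` chart, Taylor-2, orbit-uniform `hS2`): the remaining qualitative hypothesis `hsep` of
`Literature.Analysis.Asymptotics.tendsto_laplaceMethod(_fibred)` — AWAY from any neighbourhood of the critical set the action is bounded below by
a positive constant — by compactness of the configuration space `SU(N)^E` and continuity.
* §1 `exists_pos_le_of_compact_of_zero_subset` (general topology): a continuous non-negative function on a compact space is `≥ η > 0` outside
  every open set containing its zero set.
* §2 ★★ `twistedAction_separation_specialUnitary`: for `SU(N)` (`k` a unit, reference pair `B A B⁻¹ A⁻¹ = ω^k·1`), faithful unitary `ρ` and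
  ANY box `(m₀+1) × (m₁+1) × (m₂+1) × (m₃+1)`: for every OPEN set `W` of configurations containing every `g • ladder(A, B, ω^i·1, ω^j·1)` there is
  `η > 0` with `η ≤ Σ_x Σ_{μ<ν} (M − Re tr ρ(w_x · P_U(x)))` for all `U ∉ W` (K2's zero-set theorem BY NAME + §1); `twistedAction_pos_of_not_vacuum`:
  positivity off the critical set.
NOT here (honest scope): the chart-coordinate form (`δ ≤ ‖y‖ → S₀ + η ≤ S(p,y)`, which needs the tubular-neighbourhood map of M1b), anything uniform in
`β`, M3, M4; T1-box 0∕1, T1 proper 0∕1.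

HONEST FRAMING: point-set topology on one box; nothing here bears on `IRcof`, `IR`, or the Yang–Mills mass gap (Clay: NOT proved); R4 =
`BalabanLadder.UV` only.  References: K. W. Breitung, LNM 1592 (1994) Thm 41 (hypothesis: the minimum is not approached outside a neighbourhood);
A. González-Arroyo, hep-th/9807108 §4.2.
-/

set_option autoImplicit false

noncomputable section

open scoped Matrix
open Finset
open Literature.MathematicalPhysics.QuantumFieldTheory Literature.MathematicalPhysics.QuantumLattice

namespace Summit.QuantumFields.YangMills.Cruxes.IRcof.TwistedSlab

/-! ## §1 A continuous non-negative function on a compact space is bounded below away from its zero set -/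

section Topology

/-- **Separation from the zero set** (general topology): `X` compact, `f` continuous and non-negative, `W` open containing `{f = 0}` ⇒
`∃ η > 0, ∀ x ∉ W, η ≤ f x`. [folklore] -/
theorem exists_pos_le_of_compact_of_zero_subset {X : Type*} [TopologicalSpace X] [CompactSpace X] {f : X → ℝ} (hf : Continuous f)
    (hf0 : ∀ x, 0 ≤ f x) {W : Set X} (hW : IsOpen W) (hZ : ∀ x, f x = 0 → x ∈ W) :
    ∃ η : ℝ, 0 < η ∧ ∀ x, x ∉ W → η ≤ f x := by
  by_cases hne : (Wᶜ : Set X).Nonempty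
  · have hK : IsCompact (Wᶜ : Set X) := hW.isClosed_compl.isCompact
    obtain ⟨x₀, hx₀, hmin⟩ := hK.exists_isMinOn hne hf.continuousOn
    have hpos : 0 < f x₀ := by
      rcases (hf0 x₀).lt_or_eq with h | h
      · exact h
      · exact absurd (hZ x₀ h.symm) hx₀
    exact ⟨f x₀, hpos, fun x hx => hmin hx⟩
  · refine ⟨1, one_pos, fun x hx => ?_⟩
    exact absurd ⟨x, hx⟩ hne

end Topology

/-! ## §2 The twisted Wilson action of the magnetic `SU(N)` slab is bounded below away from the critical orbits -/

section Separation

variable {N : ℕ} [NeZero N] {M : ℕ} {m₀ m₁ m₂ m₃ : ℕ}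

/-- **Positivity off the critical set**: a configuration which is NOT a gauge transform of a decorated twist-eating ladder has POSITIVE twisted
action (`SU(N)`, `k` a unit, faithful unitary `ρ`; K2's zero-set theorem). [cite: Gonzalezarroyo1998, §4.2] -/
theorem twistedAction_pos_of_not_vacuum {k : ZMod N} (hk : IsUnit k) {A B : Matrix.specialUnitaryGroup (Fin N) ℂ}
    (hAB : B * A * B⁻¹ * A⁻¹ = (suCenter N k : Matrix.specialUnitaryGroup (Fin N) ℂ))
    {ρ : Matrix.specialUnitaryGroup (Fin N) ℂ →* Matrix (Fin M) (Fin M) ℂ} (hρu : ∀ g, ρ g ∈ Matrix.unitaryGroup (Fin M) ℂ)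
    (hinj : Function.Injective ρ) (U : FinTorusSite (m₀ + 1) (m₁ + 1) (m₂ + 1) (m₃ + 1) × Fin 4 → Matrix.specialUnitaryGroup (Fin N) ℂ)
    (hU : ¬ ∃ (g : FinTorusSite (m₀ + 1) (m₁ + 1) (m₂ + 1) (m₃ + 1) → Matrix.specialUnitaryGroup (Fin N) ℂ) (i j : ZMod N),
      U = gaugeAct g (ladderConfig ![A, B, (suCenter N i : Matrix.specialUnitaryGroup (Fin N) ℂ),
        (suCenter N j : Matrix.specialUnitaryGroup (Fin N) ℂ)])) :
    0 < ∑ x : FinTorusSite (m₀ + 1) (m₁ + 1) (m₂ + 1) (m₃ + 1), ∑ q : {q : Fin 4 × Fin 4 // q.1 < q.2},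
      ((M : ℝ) - (ρ (tHooftTwistTensor (slabTwist (suCenter N k : Matrix.specialUnitaryGroup (Fin N) ℂ) 1) x q.1.1 q.1.2 *
        finTorusPlaquette U x q.1.1 q.1.2)).trace.re) := by
  rcases (twistedAction_nonneg hρu (slabTwist (suCenter N k : Matrix.specialUnitaryGroup (Fin N) ℂ) 1) U).lt_or_eq with h | h
  · exact h
  · exact absurd ((twistedAction_eq_zero_iff_exists_gaugeAct_ladder_specialUnitary hk hAB hρu hinj U).1 h.symm) hU

/-- ★★ **SEPARATION (`hsep` of the Laplace method, configuration-space form).**  `SU(N)`, `k` a unit, reference pair `B A B⁻¹ A⁻¹ = ω^k·1`,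
CONTINUOUS faithful unitary `ρ`, any box with all sides `≥ 1`.  For every OPEN set `W` of configurations containing every classical vacuum
`g • ladder(A, B, ω^i·1, ω^j·1)` there is `η > 0` such that the twisted Wilson action of the magnetic slab is `≥ η` at every configuration
outside `W` — the minimum value `0` is not approached away from the critical orbits (compactness of `SU(N)^E`). [cite: Breitung1994, Thm 41
(hypotheses)] [cite: Gonzalezarroyo1998, §4.2] -/
theorem twistedAction_separation_specialUnitary {k : ZMod N} (hk : IsUnit k) {A B : Matrix.specialUnitaryGroup (Fin N) ℂ}
    (hAB : B * A * B⁻¹ * A⁻¹ = (suCenter N k : Matrix.specialUnitaryGroup (Fin N) ℂ))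
    {ρ : Matrix.specialUnitaryGroup (Fin N) ℂ →* Matrix (Fin M) (Fin M) ℂ} (hρc : Continuous ρ)
    (hρu : ∀ g, ρ g ∈ Matrix.unitaryGroup (Fin M) ℂ) (hinj : Function.Injective ρ)
    {W : Set (FinTorusSite (m₀ + 1) (m₁ + 1) (m₂ + 1) (m₃ + 1) × Fin 4 → Matrix.specialUnitaryGroup (Fin N) ℂ)} (hW : IsOpen W)
    (hWZ : ∀ (g : FinTorusSite (m₀ + 1) (m₁ + 1) (m₂ + 1) (m₃ + 1) → Matrix.specialUnitaryGroup (Fin N) ℂ) (i j : ZMod N),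
      gaugeAct g (ladderConfig ![A, B, (suCenter N i : Matrix.specialUnitaryGroup (Fin N) ℂ),
        (suCenter N j : Matrix.specialUnitaryGroup (Fin N) ℂ)]) ∈ W) :
    ∃ η : ℝ, 0 < η ∧ ∀ U : FinTorusSite (m₀ + 1) (m₁ + 1) (m₂ + 1) (m₃ + 1) × Fin 4 → Matrix.specialUnitaryGroup (Fin N) ℂ, U ∉ W →
      η ≤ ∑ x : FinTorusSite (m₀ + 1) (m₁ + 1) (m₂ + 1) (m₃ + 1), ∑ q : {q : Fin 4 × Fin 4 // q.1 < q.2},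
        ((M : ℝ) - (ρ (tHooftTwistTensor (slabTwist (suCenter N k : Matrix.specialUnitaryGroup (Fin N) ℂ) 1) x q.1.1 q.1.2 *
          finTorusPlaquette U x q.1.1 q.1.2)).trace.re) := by
  refine exists_pos_le_of_compact_of_zero_subset (continuous_twistedAction hρc _)
    (fun U => twistedAction_nonneg hρu _ U) hW fun U hU0 => ?_
  obtain ⟨g, i, j, rfl⟩ := (twistedAction_eq_zero_iff_exists_gaugeAct_ladder_specialUnitary hk hAB hρu hinj U).1 hU0
  exact hWZ g i j

/-- ★ **Separation in the defining representation** (the currency of K3–K6: `ρ = fundamentalRep (Fin N)`). [cite: Breitung1994, Thm 41 (hypotheses)] -/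
theorem twistedAction_separation_fundamental {k : ZMod N} (hk : IsUnit k) {A B : Matrix.specialUnitaryGroup (Fin N) ℂ}
    (hAB : B * A * B⁻¹ * A⁻¹ = (suCenter N k : Matrix.specialUnitaryGroup (Fin N) ℂ))
    {W : Set (FinTorusSite (m₀ + 1) (m₁ + 1) (m₂ + 1) (m₃ + 1) × Fin 4 → Matrix.specialUnitaryGroup (Fin N) ℂ)} (hW : IsOpen W)
    (hWZ : ∀ (g : FinTorusSite (m₀ + 1) (m₁ + 1) (m₂ + 1) (m₃ + 1) → Matrix.specialUnitaryGroup (Fin N) ℂ) (i j : ZMod N),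
      gaugeAct g (ladderConfig ![A, B, (suCenter N i : Matrix.specialUnitaryGroup (Fin N) ℂ),
        (suCenter N j : Matrix.specialUnitaryGroup (Fin N) ℂ)]) ∈ W) :
    ∃ η : ℝ, 0 < η ∧ ∀ U : FinTorusSite (m₀ + 1) (m₁ + 1) (m₂ + 1) (m₃ + 1) × Fin 4 → Matrix.specialUnitaryGroup (Fin N) ℂ, U ∉ W →
      η ≤ ∑ x : FinTorusSite (m₀ + 1) (m₁ + 1) (m₂ + 1) (m₃ + 1), ∑ q : {q : Fin 4 × Fin 4 // q.1 < q.2},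
        ((N : ℝ) - (fundamentalRep (Fin N) (tHooftTwistTensor (slabTwist (suCenter N k : Matrix.specialUnitaryGroup (Fin N) ℂ) 1) x q.1.1 q.1.2 *
          finTorusPlaquette U x q.1.1 q.1.2)).trace.re) :=
  twistedAction_separation_specialUnitary hk hAB (continuous_fundamentalRep (Fin N)) (fundamentalRep_mem_unitaryGroup (n := Fin N))
    (fundamentalRep_injective (Fin N)) hW hWZ

end Separation

end Summit.QuantumFields.YangMills.Cruxes.IRcof.TwistedSlab

end
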